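import Summits.QuantumFields.YangMills.Theorems.BalabanUVNodesPortZDStepLawKernel
import Summits.QuantumFields.YangMills.Theorems.BalabanUVNodesN09TransportPositiveOfLocalRoute

/-!
# NODE O port, row PT-A′ helper lane (PTZ-1, gen 3): THE DISPLAYED «STEP DEFINED» HYPOTHESES `0 < T(I(A))(V)` OF THIS SEAT's ROWS, AT THE RECORD's TRANSPORT — they are
# NON-DEGENERACY (`≠ 0`, since `TcanOfRecord` of a non-negative density is non-negative everywhere: N09's `TcanOfRecord_nonneg` BY NAME) and they FOLLOW from N09's (F3) LOCAL ROUTE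
# (`TcanOfRecord_pos_of_localRoute_of_avg_eq` BY NAME: a fine configuration of the fibre in the loop α-guard at which `I(A)` is continuous and positive, `V` regular)

[Balaban1987RG1] = [I] (CMP 109, 1987): (0.13) p. 254, (0.19) p. 255–256, (2.3) p. 265, (2.10) p. 267; [Balaban1988Convergent] = [III] (CMP 119, 1988): (3.1) p. 264.

Seat `ymgap-nodeO-port-PTZ-1` g3 (prover, HELPER MODE; `--supports stmt-QuantumFields-27930 --as helper`).  Generic layer (0 tokens of the χ-cone of record); CRIT-1 Q-5 (β).  Nothing of N09 is
restated: `Summit.QuantumFields.YangMills.BalabanUVNodes.N09TransportPositiveOfLocalRoute.TcanOfRecord_nonneg ∕ TcanOfRecord_pos_of_localRoute_of_avg_eq` (dag-n09-w2 g5) are cited BY NAME.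
WHAT IS PROVED (0 sorry; no `def` ∕ `instance` ∕ `notation`):
* `TcanOfRecord_integrand_nonneg` — `χ ≥ 0 ⇒ 0 ≤ Tcan(I(A))(V)` everywhere; ★ `TcanOfRecord_integrand_pos_iff_ne_zero` ∕ `transportOfRecord_integrand_pos_iff_ne_zero` — so the displayed positivity
  hypotheses of `…PortZDHistoryFluctuation` ∕ `…RecordHistoryFluctuation` ∕ `…RecordFirstOrder` ∕ `…ZeroInputMeasureSplit` at `TcanOfRecord = TβOfRecord₁₃` are NON-DEGENERACY of the step at
  `W_B` and at `1`, nothing more;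
* ★★ `TcanOfRecord_integrand_pos_of_localRoute` — and they HOLD on N09's local route: `k < K`, `χ ≥ 0`, `I(A)` measurable and `dU`-integrable, a fine configuration `U⋆` with `Ū(U⋆) = V` in
  the loop `α`-guard (`α ≤ 1∕24`, `α < δ_SU`, `157α < L^{−(d−1)}`) at which `I(A)` is continuous and positive, and `V ∈ regSetOfRecord (I(A))` ⟹ `0 < TcanOfRecord F N K k (I(A)) V` — at the
  record `U⋆ := V^{(k)}(V)` ([I] (2.3)) and `V := W_B`, resp. `U⋆ := 1`, `V := 1`.
HONEST FRAMING.  One-line corollaries of N09's located positivity (its α-guard ∕ continuity ∕ regularity hypotheses stay DISPLAYED); NOTHING of Bałaban's estimates asserted, ported or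
discharged; 26648 ∕ 27930⁸ SIGNED·OPEN (content-gated), 27931 OPEN (RC-3), 27932 CLOSED; K0⁷ ∕ K-Ax OPEN; N09 NOT discharged; counts unmoved; finite 𝕋⁴ at fixed ε — NOT continuum ∕ OS ∕ Clay;
the Yang–Mills mass gap is NOT proved by any of this.  No `sorry`, no `instance`, no `notation`, no `def`.
-/

noncomputable section

open MeasureTheory Set

namespace Summit.QuantumFields.YangMills.Theorems.PortZD

open Literature.MathematicalPhysics.QuantumFieldTheory.Balaban1983to89
open Literature.MathematicalPhysics.QuantumFieldTheory.Balaban1983to89.Node00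
open Literature.MathematicalPhysics.QuantumFieldTheory.Balaban1983to89.BlockAveraging (loopHol)
open Literature.MathematicalPhysics.QuantumFieldTheory.Balaban1983to89.ExpMeanLog (deltaSU)
open T4Continuum (T4Family)
open B12Eq019ActionBody (integrand)
open Summit.QuantumFields.YangMills.BalabanUVNodes.N09TransportPositiveOfLocalRoute (TcanOfRecord_nonneg TcanOfRecord_pos_of_localRoute_of_avg_eq)

variable (F : T4Family) (N : ℕ) [NeZero N]

/-- `χ ≥ 0 ⇒ 0 ≤ Tcan(I(A))(V)` everywhere (N09's `TcanOfRecord_nonneg` at `I(A) ≥ 0`). [cite: Balaban1987RG1, (0.13) p.254, (0.19) p.255 (bookkeeping)] -/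
theorem TcanOfRecord_integrand_nonneg {K k : ℕ} {χ : Density (F.P K) k (SU N)} (hχ : ∀ U, 0 ≤ χ U) (GF : Density (F.P K) k (SU N)) (gk : ℝ)
    (A : Density (F.P K) k (SU N)) (V : PBond (F.P K) (k + 1) → SU N) : 0 ≤ TcanOfRecord F N K k (integrand χ GF gk A) V :=
  TcanOfRecord_nonneg (F := F) (N := N) (integrand_nonneg_of_chi_nonneg hχ GF gk A) V

/-- ★ **POSITIVITY = NON-DEGENERACY at the record's transport**: for `χ ≥ 0`, `0 < Tcan(I(A))(V) ↔ Tcan(I(A))(V) ≠ 0`. [cite: Balaban1987RG1, (0.19) p.255–256 (bookkeeping)] -/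
theorem TcanOfRecord_integrand_pos_iff_ne_zero {K k : ℕ} {χ : Density (F.P K) k (SU N)} (hχ : ∀ U, 0 ≤ χ U) (GF : Density (F.P K) k (SU N)) (gk : ℝ)
    (A : Density (F.P K) k (SU N)) (V : PBond (F.P K) (k + 1) → SU N) :
    0 < TcanOfRecord F N K k (integrand χ GF gk A) V ↔ TcanOfRecord F N K k (integrand χ GF gk A) V ≠ 0 :=
  ⟨fun h => h.ne', fun h => lt_of_le_of_ne (TcanOfRecord_integrand_nonneg F N hχ GF gk A V) (Ne.symm h)⟩

/-- The kernel-transform edition: `0 < transportOfRecord(I(A))(V) ↔ transportOfRecord(I(A))(V) ≠ 0` for `χ ≥ 0`. [cite: Balaban1988Convergent, (3.1) p.264 (bookkeeping)] -/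
theorem transportOfRecord_integrand_pos_iff_ne_zero {K k : ℕ} {χ : Density (F.P K) k (SU N)} (hχ : ∀ U, 0 ≤ χ U) (GF : Density (F.P K) k (SU N)) (gk : ℝ)
    (A : Density (F.P K) k (SU N)) (V : GaugeField (F.P K) (k + 1) (SU N)) :
    0 < transportOfRecord F N K k (integrand χ GF gk A) V ↔ transportOfRecord F N K k (integrand χ GF gk A) V ≠ 0 :=
  ⟨fun h => h.ne', fun h => lt_of_le_of_ne (transportOfRecord_integrand_nonneg F N hχ GF gk A V) (Ne.symm h)⟩

/-- ★★ **THE DISPLAYED «STEP DEFINED AT `V`» HYPOTHESIS FROM N09's (F3) LOCAL ROUTE** (`TcanOfRecord_pos_of_localRoute_of_avg_eq` BY NAME at `ρ := I(A)`): `k < K`, `χ ≥ 0`, `I(A)` measurable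
and `dU`-integrable, a fibre point `U⋆` over `V` inside the loop `α`-guard at which `I(A)` is continuous and positive, `V` a regular point of the transform of `I(A)` ⟹ `0 < Tcan(I(A))(V)`.
[cite: Balaban1987RG1, (2.3) p.265, (0.19) p.255, (2.10) p.267] -/
theorem TcanOfRecord_integrand_pos_of_localRoute {K k : ℕ} (hk : k < K) {α : ℝ} (hα24 : α ≤ 1 / 24) (hαδ : α < deltaSU (Fin N))
    (hαL : 157 * α < (((F.P K).L : ℝ) ^ ((F.P K).d - 1))⁻¹) {χ : Density (F.P K) k (SU N)} (hχ : ∀ U, 0 ≤ χ U) (GF : Density (F.P K) k (SU N)) (gk : ℝ)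
    (A : Density (F.P K) k (SU N)) (hm : Measurable (integrand χ GF gk A)) (hi : Integrable (integrand χ GF gk A) (fieldMeasure (F.P K) k (SU N)))
    {Us : GaugeField (F.P K) k (SU N)} {V : PBond (F.P K) (k + 1) → SU N} (hUsV : (avOfRecord F N K k).avg Us = V)
    (hUα : ∀ c i, dist1 (loopHol Us c i) ≤ α) (hc : ContinuousAt (integrand χ GF gk A) Us) (hpos : 0 < integrand χ GF gk A Us)
    (hreg : V ∈ regSetOfRecord F N K k (integrand χ GF gk A)) :
    0 < TcanOfRecord F N K k (integrand χ GF gk A) V :=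
  TcanOfRecord_pos_of_localRoute_of_avg_eq hk hα24 hαδ hαL hm (integrand_nonneg_of_chi_nonneg hχ GF gk A) hi hUsV hUα hc hpos hreg

end Summit.QuantumFields.YangMills.Theorems.PortZD

end
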